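import Literature.NumberTheory.EllipticCurves.KubertTate1718SqrtNegTwoValuations
import HarnessLib

/-!
# The `5`-descent of `E_{17/18}` over `ℚ(√−2)`: the `log`-valuation table of the five Kummer VALUES (with the denominator `32`)

PROOF-ONLY file (theorems only, no definition, no named fact, no `sorry`), topic `NumberTheory/EllipticCurves`; second half of
the arithmetic input of `KubertTate1718SqrtNegTwoDescent` (split off `KubertTate1718SqrtNegTwoValuations` for the 400-line rule).
Over any number field `K` with `[K : ℚ] = 2`, `θ ∈ K`, `θ² = −2` (tree `SqrtNegTwo.FieldData θ`), at the five places
`v₀ = (θ)`, `v₁ = (1 + θ)`, `v₂ = (1 − θ)`, `v₃ = (3 + 2θ)`, `v₄ = (3 − 2θ)`: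

* `log_valuation_thirtytwo` — `log v_j (32) = [-10, 0, 0, 0, 0]` (`32 = −θ¹⁰`, `θ` ramified above `2`);
* **`log_valuation_points`** — the `log`-valuations of the five Kummer values `f_T = xy − 18x² + 324y` of `E_{17/18} = [1, -306, -5508, 0, 0]`
  at `−T = (0, 5508)`, `P₁ = (-90, 4950)`, `P₂ = (216, 4320)` (integers `1784592`, `1012500`, `1492992`) and at the two `K`-points
  `R₁ = (-3723/4, (25755 + 184263θ)/8)`, `R₂ = (-1377/4, (23409 + 46818θ)/8)` (`(-561493629 − 447206301θ)/32`, `(-70156773 − 3792258θ)/32`):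
  `[[-8,-8,-8,-1,-1], [-4,-4,-4,0,0], [-22,-6,-6,0,0], [10,-3,-2,-1,-4], [10,-8,-12,-3,-2]]` — numerator orders
  (`KubertTate1718SqrtNegTwoDescent.log_valuation_numerators`) corrected by the denominator.

Instrument for stmt-BirchSwinnertonDyer-22356 («T»); BSD is not proved by this.

## References

* [SilvermanAEC2009] J. H. Silverman, *AEC*, 2nd ed., Exercise 10.1(c), Thm. X.1.1.
* [IrelandRosen1990] K. Ireland, M. Rosen, *A Classical Introduction to Modern Number Theory*, 2nd ed., Ch. 13 §1.
-/

noncomputable section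

open scoped NumberField
open NumberField Ideal IsDedekindDomain Literature.NumberTheory.NumberFields Literature.NumberTheory.QuadraticFields

namespace Literature.NumberTheory.EllipticCurves

namespace KubertTate1718SqrtNegTwoDescent

variable {K : Type} [Field K] [NumberField K] {θ : K}

/-! ## The denominator `32` and the `log`-valuation table of the five Kummer values -/

section Table

variable (hK : SqrtNegTwo.FieldData θ) {v₀ v₁ v₂ v₃ v₄ : HeightOneSpectrum (𝓞 K)}
  (hv₀ : v₀.asIdeal = span {hK.ringEquiv ⟨0, 1⟩}) (hv₁ : v₁.asIdeal = span {hK.ringEquiv ⟨1, 1⟩})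
  (hv₂ : v₂.asIdeal = span {hK.ringEquiv ⟨1, -1⟩}) (hv₃ : v₃.asIdeal = span {hK.ringEquiv ⟨3, 2⟩})
  (hv₄ : v₄.asIdeal = span {hK.ringEquiv ⟨3, -2⟩})

include hv₀ hv₁ hv₂ hv₃ hv₄

/-- `32 = θ¹⁰ · (−1)` in `𝓞 K` (`θ² = −2`): the denominator of the two `K`-values has `log v₀ = -10` and is a unit elsewhere.
[cite: IrelandRosen1990, Ch. 13 §1] -/
theorem log_valuation_thirtytwo : ∀ j : Fin 5,
    WithZero.log ((![v₀, v₁, v₂, v₃, v₄] j).valuation K (((32 : ℤ) : 𝓞 K) : K)) = (![-10, 0, 0, 0, 0] : Fin 5 → ℤ) j := by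
  obtain ⟨hℓ₀, hℓ₁, hℓ₂, hℓ₃, hℓ₄⟩ := natCast_mem_places hK hv₀ hv₁ hv₂ hv₃ hv₄
  have hπ₀ : hK.ringEquiv ⟨0, 1⟩ ∈ v₀.asIdeal := by rw [hv₀]; exact mem_span_singleton_self _
  have c0 : WithZero.log (v₀.valuation K (((32 : ℤ) : 𝓞 K) : K)) = -10 := by
    rw [log_valuation_eq_neg_of_eq_pow_mul hv₀ 10 (y := hK.ringEquiv ⟨-1, 0⟩)
      (by rw [← hK.ringEquiv_intCast, ← map_pow, ← map_mul]; exact congrArg hK.ringEquiv (by decide))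
      (not_mem_of_eq_mul_add_intCast (ℓ := 2) (by norm_num) hℓ₀ hπ₀ (z := hK.ringEquiv ⟨0, 0⟩) (d := -1)
        (by rw [← map_mul, ← hK.ringEquiv_intCast, ← map_add]; exact congrArg hK.ringEquiv (by decide)) (by norm_num))]
    norm_num
  have c1 : WithZero.log (v₁.valuation K (((32 : ℤ) : 𝓞 K) : K)) = -0 := by
    rw [log_valuation_eq_neg_of_eq_pow_mul hv₁ 0 (y := ((32 : ℤ) : 𝓞 K)) (by rw [pow_zero, one_mul])
      (intCast_not_mem_of_not_dvd (ℓ := 3) (by norm_num) hℓ₁ (by norm_num))]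
    norm_num
  have c2 : WithZero.log (v₂.valuation K (((32 : ℤ) : 𝓞 K) : K)) = -0 := by
    rw [log_valuation_eq_neg_of_eq_pow_mul hv₂ 0 (y := ((32 : ℤ) : 𝓞 K)) (by rw [pow_zero, one_mul])
      (intCast_not_mem_of_not_dvd (ℓ := 3) (by norm_num) hℓ₂ (by norm_num))]
    norm_num
  have c3 : WithZero.log (v₃.valuation K (((32 : ℤ) : 𝓞 K) : K)) = -0 := by
    rw [log_valuation_eq_neg_of_eq_pow_mul hv₃ 0 (y := ((32 : ℤ) : 𝓞 K)) (by rw [pow_zero, one_mul])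
      (intCast_not_mem_of_not_dvd (ℓ := 17) (by norm_num) hℓ₃ (by norm_num))]
    norm_num
  have c4 : WithZero.log (v₄.valuation K (((32 : ℤ) : 𝓞 K) : K)) = -0 := by
    rw [log_valuation_eq_neg_of_eq_pow_mul hv₄ 0 (y := ((32 : ℤ) : 𝓞 K)) (by rw [pow_zero, one_mul])
      (intCast_not_mem_of_not_dvd (ℓ := 17) (by norm_num) hℓ₄ (by norm_num))]
    norm_num
  intro j
  fin_cases j
  · simpa using c0
  · simpa using c1
  · simpa using c2
  · simpa using c3
  · simpa using c4


/-- **The `log`-valuation table of the five Kummer VALUES** (numerator orders `KubertTate1718SqrtNegTwoDescent.log_valuation_numerators`,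
corrected by the denominator `32 = −θ¹⁰` of the two `K`-values): `[[-8, -8, -8, -1, -1], [-4, -4, -4, 0, 0], [-22, -6, -6, 0, 0], [10, -3, -2, -1, -4], [10, -8, -12, -3, -2]]`. [cite: SilvermanAEC2009, Exercise 10.1(c)] -/
theorem log_valuation_points : ∀ i j : Fin 5,
    WithZero.log ((![v₀, v₁, v₂, v₃, v₄] j).valuation K (![((hK.ringEquiv ⟨1784592, 0⟩ : 𝓞 K) : K), ((hK.ringEquiv ⟨1012500, 0⟩ : 𝓞 K) : K), ((hK.ringEquiv ⟨1492992, 0⟩ : 𝓞 K) : K), ((hK.ringEquiv ⟨-561493629, -447206301⟩ : 𝓞 K) : K) / 32, ((hK.ringEquiv ⟨-70156773, -3792258⟩ : 𝓞 K) : K) / 32] i)) = (![![-8, -8, -8, -1, -1], ![-4, -4, -4, 0, 0], ![-22, -6, -6, 0, 0], ![10, -3, -2, -1, -4], ![10, -8, -12, -3, -2]] : Fin 5 → Fin 5 → ℤ) i j := by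
  have hnum := log_valuation_numerators hK hv₀ hv₁ hv₂ hv₃ hv₄
  have h32 := log_valuation_thirtytwo hK hv₀ hv₁ hv₂ hv₃ hv₄
  have e32 : (32 : K) = (((32 : ℤ) : 𝓞 K) : K) := by rw [NumberField.RingOfIntegers.coe_eq_algebraMap, map_intCast]; norm_num
  have hne : ∀ (v : HeightOneSpectrum (𝓞 K)) (z : ℤ√(-2)), z ≠ 0 → v.valuation K ((hK.ringEquiv z : 𝓞 K) : K) ≠ 0 := by
    intro v z hz
    rw [Valuation.ne_zero_iff]
    intro h0
    apply hz
    have h1 : (hK.ringEquiv z : 𝓞 K) = 0 := by exact_mod_cast h0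
    exact hK.ringEquiv.map_eq_zero_iff.mp h1
  have h32ne : ∀ v : HeightOneSpectrum (𝓞 K), v.valuation K (((32 : ℤ) : 𝓞 K) : K) ≠ 0 := by
    intro v
    rw [Valuation.ne_zero_iff]
    norm_num

  have c00 : WithZero.log (v₀.valuation K ((hK.ringEquiv ⟨1784592, 0⟩ : 𝓞 K) : K)) = -8 := by simpa using hnum 0 0
  have c01 : WithZero.log (v₁.valuation K ((hK.ringEquiv ⟨1784592, 0⟩ : 𝓞 K) : K)) = -8 := by simpa using hnum 0 1
  have c02 : WithZero.log (v₂.valuation K ((hK.ringEquiv ⟨1784592, 0⟩ : 𝓞 K) : K)) = -8 := by simpa using hnum 0 2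
  have c03 : WithZero.log (v₃.valuation K ((hK.ringEquiv ⟨1784592, 0⟩ : 𝓞 K) : K)) = -1 := by simpa using hnum 0 3
  have c04 : WithZero.log (v₄.valuation K ((hK.ringEquiv ⟨1784592, 0⟩ : 𝓞 K) : K)) = -1 := by simpa using hnum 0 4
  have c10 : WithZero.log (v₀.valuation K ((hK.ringEquiv ⟨1012500, 0⟩ : 𝓞 K) : K)) = -4 := by simpa using hnum 1 0
  have c11 : WithZero.log (v₁.valuation K ((hK.ringEquiv ⟨1012500, 0⟩ : 𝓞 K) : K)) = -4 := by simpa using hnum 1 1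
  have c12 : WithZero.log (v₂.valuation K ((hK.ringEquiv ⟨1012500, 0⟩ : 𝓞 K) : K)) = -4 := by simpa using hnum 1 2
  have c13 : WithZero.log (v₃.valuation K ((hK.ringEquiv ⟨1012500, 0⟩ : 𝓞 K) : K)) = 0 := by simpa using hnum 1 3
  have c14 : WithZero.log (v₄.valuation K ((hK.ringEquiv ⟨1012500, 0⟩ : 𝓞 K) : K)) = 0 := by simpa using hnum 1 4
  have c20 : WithZero.log (v₀.valuation K ((hK.ringEquiv ⟨1492992, 0⟩ : 𝓞 K) : K)) = -22 := by simpa using hnum 2 0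
  have c21 : WithZero.log (v₁.valuation K ((hK.ringEquiv ⟨1492992, 0⟩ : 𝓞 K) : K)) = -6 := by simpa using hnum 2 1
  have c22 : WithZero.log (v₂.valuation K ((hK.ringEquiv ⟨1492992, 0⟩ : 𝓞 K) : K)) = -6 := by simpa using hnum 2 2
  have c23 : WithZero.log (v₃.valuation K ((hK.ringEquiv ⟨1492992, 0⟩ : 𝓞 K) : K)) = 0 := by simpa using hnum 2 3
  have c24 : WithZero.log (v₄.valuation K ((hK.ringEquiv ⟨1492992, 0⟩ : 𝓞 K) : K)) = 0 := by simpa using hnum 2 4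
  have n30 : WithZero.log (v₀.valuation K ((hK.ringEquiv ⟨-561493629, -447206301⟩ : 𝓞 K) : K)) = -0 := by simpa using hnum 3 0
  have d30 : WithZero.log (v₀.valuation K (((32 : ℤ) : 𝓞 K) : K)) = -10 := by simpa using h32 0
  have c30 : WithZero.log (v₀.valuation K (((hK.ringEquiv ⟨-561493629, -447206301⟩ : 𝓞 K) : K) / 32)) = 10 := by
    rw [e32, map_div₀, WithZero.log_div (hne _ _ (by decide)) (h32ne _), n30, d30]; norm_num
  have n31 : WithZero.log (v₁.valuation K ((hK.ringEquiv ⟨-561493629, -447206301⟩ : 𝓞 K) : K)) = -3 := by simpa using hnum 3 1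
  have d31 : WithZero.log (v₁.valuation K (((32 : ℤ) : 𝓞 K) : K)) = 0 := by simpa using h32 1
  have c31 : WithZero.log (v₁.valuation K (((hK.ringEquiv ⟨-561493629, -447206301⟩ : 𝓞 K) : K) / 32)) = -3 := by
    rw [e32, map_div₀, WithZero.log_div (hne _ _ (by decide)) (h32ne _), n31, d31]; norm_num
  have n32 : WithZero.log (v₂.valuation K ((hK.ringEquiv ⟨-561493629, -447206301⟩ : 𝓞 K) : K)) = -2 := by simpa using hnum 3 2
  have d32 : WithZero.log (v₂.valuation K (((32 : ℤ) : 𝓞 K) : K)) = 0 := by simpa using h32 2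
  have c32 : WithZero.log (v₂.valuation K (((hK.ringEquiv ⟨-561493629, -447206301⟩ : 𝓞 K) : K) / 32)) = -2 := by
    rw [e32, map_div₀, WithZero.log_div (hne _ _ (by decide)) (h32ne _), n32, d32]; norm_num
  have n33 : WithZero.log (v₃.valuation K ((hK.ringEquiv ⟨-561493629, -447206301⟩ : 𝓞 K) : K)) = -1 := by simpa using hnum 3 3
  have d33 : WithZero.log (v₃.valuation K (((32 : ℤ) : 𝓞 K) : K)) = 0 := by simpa using h32 3
  have c33 : WithZero.log (v₃.valuation K (((hK.ringEquiv ⟨-561493629, -447206301⟩ : 𝓞 K) : K) / 32)) = -1 := by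
    rw [e32, map_div₀, WithZero.log_div (hne _ _ (by decide)) (h32ne _), n33, d33]; norm_num
  have n34 : WithZero.log (v₄.valuation K ((hK.ringEquiv ⟨-561493629, -447206301⟩ : 𝓞 K) : K)) = -4 := by simpa using hnum 3 4
  have d34 : WithZero.log (v₄.valuation K (((32 : ℤ) : 𝓞 K) : K)) = 0 := by simpa using h32 4
  have c34 : WithZero.log (v₄.valuation K (((hK.ringEquiv ⟨-561493629, -447206301⟩ : 𝓞 K) : K) / 32)) = -4 := by
    rw [e32, map_div₀, WithZero.log_div (hne _ _ (by decide)) (h32ne _), n34, d34]; norm_num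
  have n40 : WithZero.log (v₀.valuation K ((hK.ringEquiv ⟨-70156773, -3792258⟩ : 𝓞 K) : K)) = -0 := by simpa using hnum 4 0
  have d40 : WithZero.log (v₀.valuation K (((32 : ℤ) : 𝓞 K) : K)) = -10 := by simpa using h32 0
  have c40 : WithZero.log (v₀.valuation K (((hK.ringEquiv ⟨-70156773, -3792258⟩ : 𝓞 K) : K) / 32)) = 10 := by
    rw [e32, map_div₀, WithZero.log_div (hne _ _ (by decide)) (h32ne _), n40, d40]; norm_num
  have n41 : WithZero.log (v₁.valuation K ((hK.ringEquiv ⟨-70156773, -3792258⟩ : 𝓞 K) : K)) = -8 := by simpa using hnum 4 1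
  have d41 : WithZero.log (v₁.valuation K (((32 : ℤ) : 𝓞 K) : K)) = 0 := by simpa using h32 1
  have c41 : WithZero.log (v₁.valuation K (((hK.ringEquiv ⟨-70156773, -3792258⟩ : 𝓞 K) : K) / 32)) = -8 := by
    rw [e32, map_div₀, WithZero.log_div (hne _ _ (by decide)) (h32ne _), n41, d41]; norm_num
  have n42 : WithZero.log (v₂.valuation K ((hK.ringEquiv ⟨-70156773, -3792258⟩ : 𝓞 K) : K)) = -12 := by simpa using hnum 4 2
  have d42 : WithZero.log (v₂.valuation K (((32 : ℤ) : 𝓞 K) : K)) = 0 := by simpa using h32 2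
  have c42 : WithZero.log (v₂.valuation K (((hK.ringEquiv ⟨-70156773, -3792258⟩ : 𝓞 K) : K) / 32)) = -12 := by
    rw [e32, map_div₀, WithZero.log_div (hne _ _ (by decide)) (h32ne _), n42, d42]; norm_num
  have n43 : WithZero.log (v₃.valuation K ((hK.ringEquiv ⟨-70156773, -3792258⟩ : 𝓞 K) : K)) = -3 := by simpa using hnum 4 3
  have d43 : WithZero.log (v₃.valuation K (((32 : ℤ) : 𝓞 K) : K)) = 0 := by simpa using h32 3
  have c43 : WithZero.log (v₃.valuation K (((hK.ringEquiv ⟨-70156773, -3792258⟩ : 𝓞 K) : K) / 32)) = -3 := by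
    rw [e32, map_div₀, WithZero.log_div (hne _ _ (by decide)) (h32ne _), n43, d43]; norm_num
  have n44 : WithZero.log (v₄.valuation K ((hK.ringEquiv ⟨-70156773, -3792258⟩ : 𝓞 K) : K)) = -2 := by simpa using hnum 4 4
  have d44 : WithZero.log (v₄.valuation K (((32 : ℤ) : 𝓞 K) : K)) = 0 := by simpa using h32 4
  have c44 : WithZero.log (v₄.valuation K (((hK.ringEquiv ⟨-70156773, -3792258⟩ : 𝓞 K) : K) / 32)) = -2 := by
    rw [e32, map_div₀, WithZero.log_div (hne _ _ (by decide)) (h32ne _), n44, d44]; norm_num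
  intro i j
  fin_cases i <;> fin_cases j
  · simpa using c00
  · simpa using c01
  · simpa using c02
  · simpa using c03
  · simpa using c04
  · simpa using c10
  · simpa using c11
  · simpa using c12
  · simpa using c13
  · simpa using c14
  · simpa using c20
  · simpa using c21
  · simpa using c22
  · simpa using c23
  · simpa using c24
  · simpa using c30
  · simpa using c31
  · simpa using c32
  · simpa using c33
  · simpa using c34
  · simpa using c40
  · simpa using c41
  · simpa using c42
  · simpa using c43
  · simpa using c44

end Table

end KubertTate1718SqrtNegTwoDescent

end Literature.NumberTheory.EllipticCurves

end
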